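import Literature.Probability.RandomPlanarGeometry.HexSAWHexagonSurgeryHalfSpace
import Literature.Probability.RandomPlanarGeometry.HexSAWBrickWallBridges
import Literature.Probability.RandomPlanarGeometry.HexSAWBrickWallBridgeEnvelope
import Literature.Probability.RandomPlanarGeometry.HexSAWRunDensity
import Literature.Probability.RandomPlanarGeometry.HexSAWRatioEngine
import Literature.Probability.RandomPlanarGeometry.SAWKestenInequalityAbstractNoGrowth
import HarnessLib

/-!
# Kesten's two-step inequality for HALF-SPACE walks on the hexagonal lattice (crux K79)

Topic `Literature/Probability/RandomPlanarGeometry`. Lane «pcv-sawmu», door R79 «HEX-HALFSPACE-RATIO-2(-RATE)»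
(`h_{N+2}(ℍ)/h_N(ℍ) → 2 + √2` for the brick-wall half-space walks `HexBW.halfSpaceCount` of
`HexSAWBrickWallWalks.lean`). Sources: N. Madras, G. Slade, *The Self-Avoiding Walk* (1993), §7.3, proof of
Theorem 7.3.2, pp. 245–247 (the pair countings (7.3.5)–(7.3.7), the Schwarz step (7.3.8)–(7.3.11), the density
input (7.3.12); the `U/V` argument is performed inside a sub-class `W_N` of walks — (a) all walks, (b) bridges,
(c) fixed endpoint — and the half-space class is our analogue); G. Lawler, O. Schramm, W. Werner (2004), (A.3)
(`h_{N+1}/h_N → μ` on `ℤ^d`, hence `h_{N+2}/h_N → μ²`; nothing printed for `ℍ`).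

Pieces, all on the half-space hexagon surgery `HexSAWHexagonSurgeryHalfSpace.lean` (`hexHalfFin`, `hexSlotsH`,
`hexSharpH`):
* the SEAM `card_hexHalfFin : #(hexHalfFin N) = HexBW.halfSpaceCount N` (list model `HV` ↔ brick-wall vertex
  functions, by `bwIso` and `HexBW.ofList`);
* (P1-H) `halfKesten_P1'`, (P2-H) `sum_card_hexSlotsH_div_le`, `halfKesten_P2` — the transfer counts (ports of the
  lane's `HV.hexKesten_P1'` / `HV.hexKesten_P2` to the restricted carriers, constants `27 / 324 / 54`);
* (P3-H) `halfKesten_P3` — density of counted deletion sites among half-space walks, per parity class, from the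
  EXPONENTIAL run-density `HV.DetourDensityHex_holds` (`HexSAWRunDensity.lean`), `J ≤ J_H + 3`, and the bridge lower
  envelope `e^{-9√M} μ_ℍ^{2M} ≤ μ_ℍ b_{2M}` (`HexSAWBrickWallBridgeEnvelope.lean`) with `b ≤ h`; the analytic step
  `(1/2)^{⌊N/Q⌋} e^{c√N} N^p ≤ C` is `half_pow_mul_exp_sqrt_mul_pow_le`;
* ASSEMBLY `hexHalfSpaceKestenTwo_parity` (the no-growth abstract Kesten inequality
  `SAW.kesten_ineq_of_transfer_noGrowth` along `N = 2m + δ`) and **`hexHalfSpaceKestenTwo`**: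
  `∃ D, ∀ᶠ N, (h_{N+2}/h_N)² − D/N ≤ (h_{N+2}/h_N)(h_{N+4}/h_{N+2})` (= the lane face
  `PcvSawmuG13R79.HexHalfSpaceKestenTwo`, merged over the two parities by `kestenIneqTwo_of_parity`).
-/

noncomputable section

open Finset Filter Topology
open Literature.Probability.LatticeModels Literature.Probability.Percolation SimpleGraph

namespace Literature.Probability.RandomPlanarGeometry.SAW.HV

/-! ### The seam: `#(hexHalfFin N) = h_N(ℍ)` -/

section Seam

/-- Values of the transported vertex function `HexBW.ofList N (ω.map hvToBW)`. [cite: MadrasSlade1993, §1.1] -/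
private theorem ofList_map_apply (N : ℕ) (ω : List HV) (i : ℕ) :
    HexBW.ofList N (ω.map hvToBW) i = hvToBW (ω.getD (min i N) hvOrigin) := by
  simp only [HexBW.ofList]
  have h0 : hvToBW hvOrigin = 0 := by rw [← bwToHV_zero, hvToBW_bwToHV]
  rw [← h0, List.getD_map]

/-- The brick-wall list of an `ℍ`-walk is a brick-wall walk. [cite: MadrasSlade1993, §1.1] -/
private theorem map_hvToBW_mem_sawLists' {N : ℕ} {ω : List HV} (hω : ω ∈ sawFin hvOrigin N) :
    ω.map hvToBW ∈ sawLists brickWallGraph (0 : Site 2) N := by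
  have h := (map_mem_sawLists_iff bwIso.symm (v := hvOrigin) (n := N) (l := ω)).2 (mem_sawFin_iff.1 hω)
  have e : (⇑bwIso.symm : HV → Site 2) = hvToBW := funext fun _ => rfl
  have h0 : hvToBW hvOrigin = 0 := by rw [← bwToHV_zero, hvToBW_bwToHV]
  rwa [e, h0] at h

/-- The transport `ω ↦ HexBW.ofList N (ω.map hvToBW)` is injective on `S_N(ℍ)`. [cite: MadrasSlade1993, §1.1] -/
private theorem ofList_map_injOn (N : ℕ) :
    Set.InjOn (fun ω : List HV => HexBW.ofList N (ω.map hvToBW)) ↑(sawFin hvOrigin N) := by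
  intro ω hω ω' hω' h
  have h1 := HexBW.ofList_injOn N (map_hvToBW_mem_sawLists' hω) (map_hvToBW_mem_sawLists' hω') h
  exact (List.map_injective_iff.2 bwEquiv.symm.injective) h1

/-- The half-space condition is transported. [cite: MadrasSlade1993, Definition 3.1.2, p. 58] -/
private theorem isHalfSpace_ofList_map_iff {N : ℕ} (ω : List HV) :
    Zd.IsHalfSpace N (HexBW.ofList N (ω.map hvToBW)) ↔ ∀ j, 1 ≤ j → j ≤ N → Above ω (ω.getD j hvOrigin) := by
  simp only [Zd.IsHalfSpace, Above]
  refine forall_congr' fun i => forall_congr' fun h1 => forall_congr' fun h2 => ?_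
  rw [ofList_map_apply, ofList_map_apply, Nat.zero_min, min_eq_left h2]

open Classical in
/-- The image of `hexHalfFin N` under the transport is `HexBW.halfSpaceWalks N`. [cite: MadrasSlade1993, Definition 3.1.2, p. 58] -/
private theorem image_ofList_map_hexHalfFin (N : ℕ) :
    (hexHalfFin N).image (fun ω : List HV => HexBW.ofList N (ω.map hvToBW)) = HexBW.halfSpaceWalks N := by
  ext f
  rw [Finset.mem_image, HexBW.mem_halfSpaceWalks]
  simp only [mem_hexHalfFin]
  constructor
  · rintro ⟨ω, ⟨hω, hb⟩, rfl⟩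
    have hs : HexBW.ofList N (ω.map hvToBW) ∈ HexBW.saws N := by
      have : HexBW.ofList N (ω.map hvToBW) ∈ HexBW.ofList N '' sawLists brickWallGraph (0 : Site 2) N :=
        ⟨ω.map hvToBW, map_hvToBW_mem_sawLists' hω, rfl⟩
      rw [HexBW.ofList_image] at this
      exact Finset.mem_coe.1 this
    exact ⟨hs, (isHalfSpace_ofList_map_iff ω).2 hb⟩
  · rintro ⟨hf, hb⟩
    have hf' : f ∈ HexBW.ofList N '' sawLists brickWallGraph (0 : Site 2) N := by
      rw [HexBW.ofList_image]; exact Finset.mem_coe.2 hf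
    obtain ⟨l, hl, rfl⟩ := hf'
    set ω : List HV := l.map bwToHV with hωdef
    have hωl : ω.map hvToBW = l := by
      rw [hωdef, List.map_map]
      convert List.map_id l
      funext x
      exact hvToBW_bwToHV x
    have hω : ω ∈ sawFin hvOrigin N := by
      rw [mem_sawFin_iff]
      have h := (map_mem_sawLists_iff bwIso (v := (0 : Site 2)) (n := N) (l := l)).2 hl
      have e : (⇑bwIso : Site 2 → HV) = bwToHV := funext bwIso_apply
      rwa [e, bwToHV_zero] at h
    refine ⟨ω, ⟨hω, (isHalfSpace_ofList_map_iff ω).1 ?_⟩, by rw [hωl]⟩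
    rw [hωl]; exact hb

open Classical in
/-- **`#(hexHalfFin N) = h_N(ℍ)`**: the list-model half-space walks of `ℍ` are in bijection with the brick-wall
half-space walks `HexBW.halfSpaceWalks N`. [cite: MadrasSlade1993, Definition 3.1.2, p. 58] -/
theorem card_hexHalfFin (N : ℕ) : #(hexHalfFin N) = HexBW.halfSpaceCount N := by
  rw [HexBW.halfSpaceCount, ← image_ofList_map_hexHalfFin, Finset.card_image_of_injOn]
  exact (ofList_map_injOn N).mono (Finset.coe_subset.2 fun ω h => mem_sawFin_of_mem_hexHalfFin h)

/-- Half-space walks exist: `0 < #(hexHalfFin N)` (`h_N ≥ b_N ≥ 1`). [cite: MadrasSlade1993, Definition 3.1.2, p. 58 (every bridge is a half-space walk)] -/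
theorem card_hexHalfFin_pos (N : ℕ) : 0 < #(hexHalfFin N) := by
  rw [card_hexHalfFin]
  exact lt_of_lt_of_le (HexBW.one_le_bridgeCount N)
    (card_le_card (HexBW.bridges_subset_halfSpaceWalks N))

/-- `b_N(ℍ) ≤ h_N(ℍ) = #(hexHalfFin N)`. [cite: MadrasSlade1993, Definition 3.1.2, p. 58 (every bridge is a half-space walk)] -/
theorem bridgeCount_le_card_hexHalfFin (N : ℕ) : HexBW.bridgeCount N ≤ #(hexHalfFin N) := by
  rw [card_hexHalfFin]
  exact card_le_card (HexBW.bridges_subset_halfSpaceWalks N)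

end Seam

/-! ### (P1-H) and (P2-H): the transfer counts on half-space walks -/

section Transfer

/-- **(P1-H), the first counting on half-space walks of `ℍ`** (Madras–Slade (7.3.6) with inexact bookkeeping), in
the shape of hypothesis `hP1` (`c₁ = 27`) of the abstract Kesten inequality: the number of `(N+2)`-step half-space
walks with at least one counted deletion site equals `Σ_{(ω,s)} 1/J_H(hexIns_s ω)` over the admissible slot pairs of
`H_N(ℍ)`, and `J_H(hexIns_s ω) ≥ max(J_H(ω) − 27, 1)`. [cite: MadrasSlade1993, Theorem 7.3.2 (proof), (7.3.6) p. 246 (inside a sub-class W_N, p. 245)] -/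
theorem halfKesten_P1' (N : ℕ) :
    (#((hexHalfFin (N + 2)).filter fun ω' => 1 ≤ #(hexSharpH ω')) : ℝ) ≤
      ∑ ω ∈ hexHalfFin N, (#(hexSlotsH ω) : ℝ) / max ((#(hexSharpH ω) : ℝ) - 27) 1 := by
  -- the left side is `Σ_{ω'} J(ω') · (1/J(ω'))`, a sum over the deletion-site pairs of `S_{N+2}(ℍ)`
  have hJ : (#((hexHalfFin (N + 2)).filter fun ω' => 1 ≤ #(hexSharpH ω')) : ℝ) =
      ∑ ω ∈ hexHalfFin (N + 2), (#(hexSharpH ω) : ℝ) * (1 / (#(hexSharpH ω) : ℝ)) := by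
    rw [card_eq_sum_ones, Nat.cast_sum, sum_filter]
    refine sum_congr rfl fun ω _ => ?_
    by_cases h : 1 ≤ #(hexSharpH ω)
    · rw [if_pos h, Nat.cast_one, mul_one_div_cancel]
      exact_mod_cast (show #(hexSharpH ω) ≠ 0 by omega)
    · rw [if_neg h, show #(hexSharpH ω) = 0 by omega]
      simp
  rw [hJ, ← sum_hexSharpPairsH (N + 2) (fun ω => 1 / (#(hexSharpH ω) : ℝ)),
    ← sum_hexSlotPairsH_eq_sum_hexSharpPairsH N (fun p => 1 / (#(hexSharpH (hexIns p.2.1 p.2.2.1 p.2.2.2.1 p.2.2.2.2 p.1)) : ℝ))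
      (fun q => 1 / (#(hexSharpH q.1) : ℝ)) (fun p _ => rfl)]
  -- termwise `1/J(ins) ≤ 1/max(J − 27, 1)`, then re-sum over walks
  have hR : ∑ ω ∈ hexHalfFin N, (#(hexSlotsH ω) : ℝ) / max ((#(hexSharpH ω) : ℝ) - 27) 1 =
      ∑ p ∈ hexSlotPairsH N, 1 / max ((#(hexSharpH p.1) : ℝ) - 27) 1 := by
    rw [sum_hexSlotPairsH N (fun ω => 1 / max ((#(hexSharpH ω) : ℝ) - 27) 1)]
    refine sum_congr rfl fun ω _ => ?_
    rw [mul_one_div]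
  rw [hR]
  refine sum_le_sum fun p hp => ?_
  obtain ⟨ω, m, x, y, z⟩ := p
  rw [hexSlotPairsH, mem_sigma] at hp
  dsimp only at hp ⊢
  obtain ⟨hω, hs⟩ := hp
  have h1 : (1 : ℝ) ≤ #(hexSharpH (hexIns m x y z ω)) := by exact_mod_cast one_le_card_hexSharpH_hexIns hω hs
  have h2 : (#(hexSharpH ω) : ℝ) - 27 ≤ #(hexSharpH (hexIns m x y z ω)) := by
    have := card_hexSharpH_le_hexIns hω hs
    have h' : (#(hexSharpH ω) : ℝ) ≤ #(hexSharpH (hexIns m x y z ω)) + 27 := by exact_mod_cast this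
    linarith
  exact one_div_le_one_div_of_le (lt_of_lt_of_le one_pos (le_max_right _ _)) (max_le h2 h1)


/-- **Level `N+2` (single step of (7.3.7)) on half-space walks**: `Σ_{ω' ∈ H_{N+2}} I_H(ω')/(J_H(ω')+27) ≤ h_{N+4}`.
[cite: MadrasSlade1993, Theorem 7.3.2 (proof), eq. (7.3.7) p. 246] -/
theorem sum_card_hexSlotsH_div_le (N : ℕ) :
    ∑ ω ∈ hexHalfFin (N + 2), (#(hexSlotsH ω) : ℝ) / ((#(hexSharpH ω) : ℝ) + 27) ≤ (#(hexHalfFin (N + 4)) : ℝ) := by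
  classical
  have e1 : ∑ ω ∈ hexHalfFin (N + 2), (#(hexSlotsH ω) : ℝ) / ((#(hexSharpH ω) : ℝ) + 27) =
      ∑ p ∈ hexSlotPairsH (N + 2), 1 / ((#(hexSharpH p.1) : ℝ) + 27) := by
    rw [sum_hexSlotPairsH (N + 2) (fun ω => 1 / ((#(hexSharpH ω) : ℝ) + 27))]
    exact sum_congr rfl fun ω _ => by rw [mul_one_div]
  have e2 : ∑ p ∈ hexSlotPairsH (N + 2), 1 / ((#(hexSharpH p.1) : ℝ) + 27) ≤
      ∑ p ∈ hexSlotPairsH (N + 2), 1 / (#(hexSharpH (hexIns p.2.1 p.2.2.1 p.2.2.2.1 p.2.2.2.2 p.1)) : ℝ) := by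
    refine sum_le_sum fun p hp => ?_
    rw [hexSlotPairsH, Finset.mem_sigma] at hp
    obtain ⟨hω, hs⟩ := hp
    have hs' : (p.2.1, p.2.2.1, p.2.2.2.1, p.2.2.2.2) ∈ hexSlotsH p.1 := hs
    have hJ1 := one_le_card_hexSharpH_hexIns hω hs'
    have hJ3 := card_hexSharpH_hexIns_le hω hs'
    have hpos : (0 : ℝ) < #(hexSharpH (hexIns p.2.1 p.2.2.1 p.2.2.2.1 p.2.2.2.2 p.1)) := by exact_mod_cast hJ1
    apply one_div_le_one_div_of_le hpos
    exact_mod_cast hJ3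
  have e3 : ∑ p ∈ hexSlotPairsH (N + 2), 1 / (#(hexSharpH (hexIns p.2.1 p.2.2.1 p.2.2.2.1 p.2.2.2.2 p.1)) : ℝ) =
      ∑ q ∈ hexSharpPairsH (N + 2 + 2), 1 / (#(hexSharpH q.1) : ℝ) :=
    sum_hexSlotPairsH_eq_sum_hexSharpPairsH (N + 2) _ (fun q => 1 / (#(hexSharpH q.1) : ℝ)) fun p _ => rfl
  have e4 : ∑ q ∈ hexSharpPairsH (N + 2 + 2), 1 / (#(hexSharpH q.1) : ℝ) ≤ (#(hexHalfFin (N + 4)) : ℝ) := by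
    rw [sum_hexSharpPairsH (N + 2 + 2) (fun ω => 1 / (#(hexSharpH ω) : ℝ)), show N + 4 = N + 2 + 2 by ring,
      Finset.card_eq_sum_ones, Nat.cast_sum]
    refine sum_le_sum fun ω _ => ?_
    by_cases h : #(hexSharpH ω) = 0
    · rw [h]; simp
    · rw [mul_one_div_cancel (by exact_mod_cast h)]; simp
  rw [e1]
  exact e2.trans (e3.le.trans e4)

/-- **(P2-H) The double transfer on half-space walks of `ℍ`** (Madras–Slade (7.3.7)):
`Σ_{ω ∈ H_N(ℍ)} I_H(ω) · max(0, I_H(ω) − 324) / ((J_H(ω)+27)(J_H(ω)+54)) ≤ h_{N+4}(ℍ)` — two admissible hexagon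
insertions, counted through the restricted slot-pair/site-pair bijection twice, with the bookkeeping
`1 ≤ J_H' ≤ J_H + 27` and `I_H ≤ I_H' + 324` of `HexSAWHexagonSurgeryHalfSpace`.
[cite: MadrasSlade1993, Theorem 7.3.2 (proof), eq. (7.3.7) p. 246 (inside a sub-class W_N, p. 245)] -/
theorem halfKesten_P2 (N : ℕ) :
    ∑ ω ∈ hexHalfFin N, (#(hexSlotsH ω) : ℝ) * max 0 ((#(hexSlotsH ω) : ℝ) - 324) /
        (((#(hexSharpH ω) : ℝ) + 27) * ((#(hexSharpH ω) : ℝ) + 54)) ≤ (#(hexHalfFin (N + 4)) : ℝ) := by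
  classical
  refine le_trans ?_ (sum_card_hexSlotsH_div_le N)
  -- level `N`: the weight `g(ω') = I'/((J'+3) J')`, so that `J' · g(ω') = I'/(J'+3)` when `J' ≥ 1`
  set g : List HV → ℝ := fun ω' =>
    (#(hexSlotsH ω') : ℝ) / (((#(hexSharpH ω') : ℝ) + 27) * (#(hexSharpH ω') : ℝ)) with hg
  have hB : ∑ ω' ∈ hexHalfFin (N + 2), (#(hexSharpH ω') : ℝ) * g ω' ≤
      ∑ ω' ∈ hexHalfFin (N + 2), (#(hexSlotsH ω') : ℝ) / ((#(hexSharpH ω') : ℝ) + 27) := by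
    refine sum_le_sum fun ω' _ => ?_
    by_cases h : #(hexSharpH ω') = 0
    · rw [h]; simp only [Nat.cast_zero, zero_mul, zero_add]; positivity
    · have hpos : (0 : ℝ) < #(hexSharpH ω') := by exact_mod_cast Nat.pos_of_ne_zero h
      rw [hg]
      rw [show (#(hexSharpH ω') : ℝ) * ((#(hexSlotsH ω') : ℝ) /
          (((#(hexSharpH ω') : ℝ) + 27) * (#(hexSharpH ω') : ℝ))) =
          (#(hexSlotsH ω') : ℝ) / ((#(hexSharpH ω') : ℝ) + 27) by field_simp]
  refine le_trans ?_ hB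
  rw [← sum_hexSharpPairsH (N + 2) g]
  rw [← sum_hexSlotPairsH_eq_sum_hexSharpPairsH N (fun p => g (hexIns p.2.1 p.2.2.1 p.2.2.2.1 p.2.2.2.2 p.1)) (fun q => g q.1) fun p _ => rfl]
  rw [show ∑ ω ∈ hexHalfFin N, (#(hexSlotsH ω) : ℝ) * max 0 ((#(hexSlotsH ω) : ℝ) - 324) /
      (((#(hexSharpH ω) : ℝ) + 27) * ((#(hexSharpH ω) : ℝ) + 54)) =
      ∑ ω ∈ hexHalfFin N, (#(hexSlotsH ω) : ℝ) * (max 0 ((#(hexSlotsH ω) : ℝ) - 324) /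
      (((#(hexSharpH ω) : ℝ) + 27) * ((#(hexSharpH ω) : ℝ) + 54))) from
    sum_congr rfl fun ω _ => by rw [mul_div_assoc]]
  rw [← sum_hexSlotPairsH N (fun ω => max 0 ((#(hexSlotsH ω) : ℝ) - 324) /
      (((#(hexSharpH ω) : ℝ) + 27) * ((#(hexSharpH ω) : ℝ) + 54)))]
  refine sum_le_sum fun p hp => ?_
  rw [hexSlotPairsH, Finset.mem_sigma] at hp
  obtain ⟨hω, hs⟩ := hp
  have hs' : (p.2.1, p.2.2.1, p.2.2.2.1, p.2.2.2.2) ∈ hexSlotsH p.1 := hs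
  set ω' := hexIns p.2.1 p.2.2.1 p.2.2.2.1 p.2.2.2.2 p.1 with hω'
  have hJ1 : (1 : ℝ) ≤ #(hexSharpH ω') := by exact_mod_cast one_le_card_hexSharpH_hexIns hω hs'
  have hJ3 : (#(hexSharpH ω') : ℝ) ≤ #(hexSharpH p.1) + 27 := by
    exact_mod_cast card_hexSharpH_hexIns_le hω hs'
  have hI : (#(hexSlotsH p.1) : ℝ) ≤ #(hexSlotsH ω') + 324 := by
    exact_mod_cast card_hexSlotsH_le_hexIns hω hs'
  have hJ0 : (0 : ℝ) ≤ #(hexSharpH p.1) := Nat.cast_nonneg _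
  have hI0 : (0 : ℝ) ≤ #(hexSlotsH ω') := Nat.cast_nonneg _
  show max 0 ((#(hexSlotsH p.1) : ℝ) - 324) / (((#(hexSharpH p.1) : ℝ) + 27) * ((#(hexSharpH p.1) : ℝ) + 54)) ≤ g ω'
  rw [hg]; simp only
  have hden : ((#(hexSharpH ω') : ℝ) + 27) * (#(hexSharpH ω') : ℝ) ≤
      ((#(hexSharpH p.1) : ℝ) + 27) * ((#(hexSharpH p.1) : ℝ) + 54) := by nlinarith
  have hden0 : 0 < ((#(hexSharpH ω') : ℝ) + 27) * (#(hexSharpH ω') : ℝ) := by positivity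
  rcases le_or_gt ((#(hexSlotsH p.1) : ℝ) - 324) 0 with hneg | hpos
  · rw [max_eq_left hneg, zero_div]
    exact div_nonneg hI0 hden0.le
  · rw [max_eq_right hpos.le]
    calc ((#(hexSlotsH p.1) : ℝ) - 324) / (((#(hexSharpH p.1) : ℝ) + 27) * ((#(hexSharpH p.1) : ℝ) + 54))
        ≤ ((#(hexSlotsH p.1) : ℝ) - 324) / (((#(hexSharpH ω') : ℝ) + 27) * (#(hexSharpH ω') : ℝ)) :=
          div_le_div_of_nonneg_left hpos.le hden0 hden
      _ ≤ (#(hexSlotsH ω') : ℝ) / (((#(hexSharpH ω') : ℝ) + 27) * (#(hexSharpH ω') : ℝ)) :=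
          div_le_div_of_nonneg_right (by linarith) hden0.le



end Transfer

/-! ### The analytic step: an exponential beats a stretched exponential times a polynomial -/

section Analytic

/-- `c √N ≤ β N + c²/(4β)` for `β > 0` (AM–GM). [folklore] -/
private theorem mul_sqrt_le {c β : ℝ} (hβ : 0 < β) (N : ℕ) :
    c * Real.sqrt N ≤ β * N + c ^ 2 / (4 * β) := by
  have hs : Real.sqrt (N : ℝ) ^ 2 = N := Real.sq_sqrt (Nat.cast_nonneg N)
  have key : 0 ≤ (2 * β * Real.sqrt N - c) ^ 2 := sq_nonneg _
  have h4 : 4 * β * (c * Real.sqrt N) ≤ 4 * β * (β * N + c ^ 2 / (4 * β)) := by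
    have e : 4 * β * (β * N + c ^ 2 / (4 * β)) = 4 * β ^ 2 * N + c ^ 2 := by
      field_simp
    rw [e]
    nlinarith [key, hs]
  exact le_of_mul_le_mul_left h4 (by positivity)

/-- `N^p ≤ e^{pβN}/β^p` for `β > 0` (from `βN ≤ e^{βN}`). [folklore] -/
private theorem natCast_pow_le_exp {β : ℝ} (hβ : 0 < β) (N p : ℕ) :
    (N : ℝ) ^ p ≤ Real.exp (p * (β * N)) / β ^ p := by
  have h1 : β * N ≤ Real.exp (β * N) := by
    have := Real.add_one_le_exp (β * N); linarith
  have h2 : (N : ℝ) ≤ Real.exp (β * N) / β := by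
    rw [le_div_iff₀ hβ]; linarith
  calc (N : ℝ) ^ p ≤ (Real.exp (β * N) / β) ^ p := pow_le_pow_left₀ (Nat.cast_nonneg N) h2 p
    _ = Real.exp (p * (β * N)) / β ^ p := by rw [div_pow, ← Real.exp_nat_mul]

/-- The floor in the exponent costs at most a factor `2`: `(1/2)^{⌊N/Q⌋} ≤ 2 e^{−(log 2/Q) N}`. [folklore] -/
private theorem half_pow_div_le {Q : ℕ} (hQ : 0 < Q) (N : ℕ) :
    (1 / 2 : ℝ) ^ (N / Q) ≤ 2 * Real.exp (-(Real.log 2 / Q) * N) := by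
  have hQ0 : (0 : ℝ) < Q := by exact_mod_cast hQ
  have hlog : 0 < Real.log 2 := Real.log_pos (by norm_num)
  -- `⌊N/Q⌋ ≥ N/Q − 1`
  have hk : (N : ℝ) / Q - 1 ≤ ((N / Q : ℕ) : ℝ) := by
    have h := Nat.lt_div_mul_add hQ (a := N)
    have h' : (N : ℝ) < ((N / Q : ℕ) : ℝ) * Q + Q := by exact_mod_cast h
    rw [div_sub_one hQ0.ne', div_le_iff₀ hQ0]
    linarith
  have e1 : (1 / 2 : ℝ) ^ (N / Q) = Real.exp (-(Real.log 2) * ((N / Q : ℕ) : ℝ)) := by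
    rw [← Real.rpow_natCast, one_div, Real.inv_rpow (by norm_num), Real.rpow_def_of_pos (by norm_num),
      ← Real.exp_neg]
    ring_nf
  have e2 : (2 : ℝ) * Real.exp (-(Real.log 2 / Q) * N) = Real.exp (-(Real.log 2) * ((N : ℝ) / Q - 1)) := by
    have : -(Real.log 2) * ((N : ℝ) / Q - 1) = -(Real.log 2 / Q) * N + Real.log 2 := by
      field_simp
      ring
    rw [this, Real.exp_add, Real.exp_log (by norm_num), mul_comm]
  rw [e1, e2]
  apply Real.exp_le_exp.2
  nlinarith

/-- **An exponential beats a stretched exponential times a polynomial**: for `Q ≥ 1`, real `c` and `p`, there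
is `C > 0` with `(1/2)^{⌊N/Q⌋} · e^{c√N} · N^p ≤ C` for every `N`. [folklore] -/
private theorem half_pow_mul_exp_sqrt_mul_pow_le {Q : ℕ} (hQ : 0 < Q) (c : ℝ) (p : ℕ) :
    ∃ C : ℝ, 0 < C ∧ ∀ N : ℕ, (1 / 2 : ℝ) ^ (N / Q) * Real.exp (c * Real.sqrt N) * (N : ℝ) ^ p ≤ C := by
  have hQ0 : (0 : ℝ) < Q := by exact_mod_cast hQ
  have hlog : 0 < Real.log 2 := Real.log_pos (by norm_num)
  -- the rate `β = log 2 / ((p+2) Q)`: then `(p+1) β ≤ log 2 / Q`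
  set β : ℝ := Real.log 2 / (((p : ℝ) + 2) * Q) with hβ
  have hβ0 : 0 < β := by rw [hβ]; positivity
  have hβle : ((p : ℝ) + 1) * β ≤ Real.log 2 / Q := by
    rw [hβ, ← sub_nonneg]
    have e : Real.log 2 / Q - ((p : ℝ) + 1) * (Real.log 2 / (((p : ℝ) + 2) * Q)) =
        Real.log 2 / (((p : ℝ) + 2) * Q) := by
      field_simp
      ring
    rw [e]
    positivity
  refine ⟨2 * Real.exp (c ^ 2 / (4 * β)) / β ^ p, by positivity, fun N => ?_⟩
  have hN0 : (0 : ℝ) ≤ N := Nat.cast_nonneg N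
  have h1 := half_pow_div_le hQ N
  have h2 : Real.exp (c * Real.sqrt N) ≤ Real.exp (β * N + c ^ 2 / (4 * β)) :=
    Real.exp_le_exp.2 (mul_sqrt_le hβ0 N)
  have h3 := natCast_pow_le_exp hβ0 N p
  have hA : 0 ≤ (1 / 2 : ℝ) ^ (N / Q) := by positivity
  have hB : 0 ≤ Real.exp (c * Real.sqrt N) := (Real.exp_pos _).le
  have hC : 0 ≤ (N : ℝ) ^ p := by positivity
  have hX : -(Real.log 2 / Q) * N + (β * N + c ^ 2 / (4 * β)) + p * (β * N) ≤ c ^ 2 / (4 * β) := by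
    have : (((p : ℝ) + 1) * β - Real.log 2 / Q) * N ≤ 0 := mul_nonpos_of_nonpos_of_nonneg (by linarith) hN0
    nlinarith
  calc (1 / 2 : ℝ) ^ (N / Q) * Real.exp (c * Real.sqrt N) * (N : ℝ) ^ p
      ≤ (2 * Real.exp (-(Real.log 2 / Q) * N)) * Real.exp (β * N + c ^ 2 / (4 * β)) *
          (Real.exp (p * (β * N)) / β ^ p) :=
        mul_le_mul (mul_le_mul h1 h2 hB (by positivity)) h3 hC (by positivity)
    _ = 2 / β ^ p * Real.exp (-(Real.log 2 / Q) * N + (β * N + c ^ 2 / (4 * β)) + p * (β * N)) := by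
        simp only [Real.exp_add]
        ring
    _ ≤ 2 / β ^ p * Real.exp (c ^ 2 / (4 * β)) :=
        mul_le_mul_of_nonneg_left (Real.exp_le_exp.2 hX) (by positivity)
    _ = 2 * Real.exp (c ^ 2 / (4 * β)) / β ^ p := by ring

end Analytic

/-! ### (P3-H): density of counted deletion sites among half-space walks -/

section Density

/-- The run-density face as a bound on the finset of walks with few deletion sites. [cite: MadrasSlade1993, Theorem 7.3.2 (proof), (7.3.12)] -/
private theorem card_filter_hexSharp_le :
    ∃ Q : ℕ, 0 < Q ∧ ∃ C : ℝ, 0 ≤ C ∧ ∀ N : ℕ,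
      (#((sawFin hvOrigin N).filter fun l => #(hexSharp l) ≤ N / (4 * Q)) : ℝ) ≤
        C * (1 / 2 : ℝ) ^ (N / Q) * hexConnectiveConstant ^ N := by
  obtain ⟨Q, hQ, C, hC⟩ := DetourDensityHex_holds
  have hμ : hexConnectiveConstant = Real.sqrt (2 + Real.sqrt 2) :=
    hexConnectiveConstant_eq_of_thm1 DuminilCopinSmirnov2012_thm1_holds
  refine ⟨Q, hQ, max C 0, le_max_right _ _, fun N => ?_⟩
  have hset : {l : List HV | l ∈ sawLists hvGraph hvOrigin N ∧ #(hexSharp l) ≤ N / (4 * Q)} =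
      ↑((sawFin hvOrigin N).filter fun l => #(hexSharp l) ≤ N / (4 * Q)) := by
    ext l
    simp only [Set.mem_setOf_eq, coe_filter, mem_sawFin_iff]
  have h := hC N
  rw [hset, Set.ncard_coe_finset, ← hμ] at h
  refine h.trans ?_
  have : 0 ≤ (1 / 2 : ℝ) ^ (N / Q) * hexConnectiveConstant ^ N := by
    have := hexConnectiveConstant_pos; positivity
  nlinarith [le_max_left C 0]

/-- **(P3-H) along a parity class**: among the half-space walks of length `2m + δ`, those with fewer than `a·m`
counted deletion sites are at most `C · h_{2m+δ} / m³` — from the exponential run density of all walks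
(`DetourDensityHex_holds`), `J ≤ J_H + 3`, and `h_N ≥ b_N ≥ e^{-9√m} μ^{2m} / μ` (the bridge lower envelope).
[cite: MadrasSlade1993, Theorem 7.3.2 (proof), (7.3.12) and p. 247] -/
theorem halfKesten_P3 {δ : ℕ} (hδ : δ ≤ 1) :
    ∃ a > (0 : ℝ), ∃ C ≥ (0 : ℝ), ∀ m ≥ (1 : ℕ),
      (#((hexHalfFin (2 * m + δ)).filter fun ω => ((#(hexSharpH ω) : ℕ) : ℝ) < a * m) : ℝ) ≤
        C * #(hexHalfFin (2 * m + δ)) / (m : ℝ) ^ 3 := by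
  obtain ⟨Q, hQ, C₀, hC₀, hface⟩ := card_filter_hexSharp_le
  obtain ⟨C₁, hC₁, hana⟩ := half_pow_mul_exp_sqrt_mul_pow_le hQ 9 3
  have hQ0 : (0 : ℝ) < Q := by exact_mod_cast hQ
  set μ := hexConnectiveConstant with hμdef
  have hμ1 : 1 ≤ μ := by
    have hhex : hexConnectiveConstant = Real.sqrt (2 + Real.sqrt 2) :=
      hexConnectiveConstant_eq_of_thm1 DuminilCopinSmirnov2012_thm1_holds
    have h2 : (1 : ℝ) ≤ 2 + Real.sqrt 2 := by have := Real.sqrt_nonneg 2; linarith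
    rw [hμdef, hhex, Real.le_sqrt (by norm_num) (by positivity)]
    simpa using h2
  have hμ0 : 0 < μ := by linarith
  -- the threshold `T = 12 Q` below which the bound is trivial
  set T : ℕ := 12 * Q with hT
  refine ⟨1 / (4 * Q), by positivity, max ((T : ℝ) ^ 3) (C₀ * μ ^ 3 * C₁), ?_, fun m hm => ?_⟩
  · exact le_trans (by positivity) (le_max_left _ _)
  set N := 2 * m + δ with hN
  set S := hexHalfFin N with hS
  have hm0 : (0 : ℝ) < m := by exact_mod_cast hm
  have hSpos : (0 : ℝ) < #S := by exact_mod_cast card_hexHalfFin_pos N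
  rcases Nat.lt_or_ge m T with hsmall | hlarge
  · -- trivial regime: `#filter ≤ #S ≤ T³ #S / m³`
    have h1 : (#(S.filter fun ω => ((#(hexSharpH ω) : ℕ) : ℝ) < 1 / (4 * Q) * m) : ℝ) ≤ #S := by
      exact_mod_cast card_filter_le _ _
    have hm3 : (m : ℝ) ^ 3 ≤ (T : ℝ) ^ 3 := by
      exact pow_le_pow_left₀ hm0.le (by exact_mod_cast hsmall.le) 3
    have h2 : (#S : ℝ) ≤ (T : ℝ) ^ 3 * #S / (m : ℝ) ^ 3 := by
      rw [le_div_iff₀ (by positivity)]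
      calc (#S : ℝ) * (m : ℝ) ^ 3 ≤ #S * (T : ℝ) ^ 3 := mul_le_mul_of_nonneg_left hm3 hSpos.le
        _ = (T : ℝ) ^ 3 * #S := by ring
    calc _ ≤ (#S : ℝ) := h1
      _ ≤ (T : ℝ) ^ 3 * #S / (m : ℝ) ^ 3 := h2
      _ ≤ max ((T : ℝ) ^ 3) (C₀ * μ ^ 3 * C₁) * #S / (m : ℝ) ^ 3 := by
          gcongr
          exact le_max_left _ _
  · -- main regime: few counted sites ⇒ few sites ⇒ exponentially few walks
    have hsub : (S.filter fun ω => ((#(hexSharpH ω) : ℕ) : ℝ) < 1 / (4 * Q) * m) ⊆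
        (sawFin hvOrigin N).filter fun l => #(hexSharp l) ≤ N / (4 * Q) := by
      intro ω hω
      rw [mem_filter] at hω ⊢
      obtain ⟨hωS, hlt⟩ := hω
      have hω' := mem_sawFin_of_mem_hexHalfFin hωS
      refine ⟨hω', ?_⟩
      have h3 := card_hexSharp_le_card_hexSharpH_add_three hωS
      -- `J ≤ J_H + 3 < m/(4Q) + 3 ≤ 2m/(4Q)` as `4Q·J ≤ N`
      rw [Nat.le_div_iff_mul_le (by omega)]
      have hr : ((#(hexSharpH ω) : ℕ) : ℝ) * (4 * Q) < m := by
        have := mul_lt_mul_of_pos_right hlt (by positivity : (0 : ℝ) < 4 * Q)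
        have e : 1 / (4 * (Q : ℝ)) * m * (4 * Q) = m := by field_simp
        rwa [e] at this
      have hr' : #(hexSharpH ω) * (4 * Q) < m := by exact_mod_cast hr
      have hT' : 12 * Q ≤ m := hlarge
      calc #(hexSharp ω) * (4 * Q) ≤ (#(hexSharpH ω) + 3) * (4 * Q) := Nat.mul_le_mul_right _ h3
        _ = #(hexSharpH ω) * (4 * Q) + 12 * Q := by ring
        _ ≤ m + m := by omega
        _ ≤ N := by omega
    have hup : (#(S.filter fun ω => ((#(hexSharpH ω) : ℕ) : ℝ) < 1 / (4 * Q) * m) : ℝ) ≤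
        C₀ * (1 / 2 : ℝ) ^ (N / Q) * μ ^ N :=
      le_trans (by exact_mod_cast card_le_card hsub) (hface N)
    -- lower envelope of `#S`: `μ^{2m} e^{-9√m} ≤ μ · b_{2m} ≤ μ · b_N ≤ μ · #S`
    have hlow : Real.exp (-(9 * Real.sqrt m)) * μ ^ (2 * m) ≤ μ * #S := by
      have h1 := HexBW.exp_neg_mul_sqrt_mul_pow_le_bridgeCount m hm
      have h2 : (HexBW.bridgeCount (2 * m) : ℝ) ≤ HexBW.bridgeCount N := by
        exact_mod_cast HexBW.bridgeCount_le_add (2 * m) δ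
      have h3 : (HexBW.bridgeCount N : ℝ) ≤ #S := by exact_mod_cast bridgeCount_le_card_hexHalfFin N
      calc Real.exp (-(9 * Real.sqrt m)) * μ ^ (2 * m) ≤ μ * HexBW.bridgeCount (2 * m) := h1
        _ ≤ μ * #S := mul_le_mul_of_nonneg_left (h2.trans h3) hμ0.le
    -- the analytic step at `m`: `(1/2)^{⌊m/Q⌋} e^{9√m} m³ ≤ C₁`, and `⌊N/Q⌋ ≥ ⌊m/Q⌋`
    have hana' := hana m
    have hhalf : (1 / 2 : ℝ) ^ (N / Q) ≤ (1 / 2 : ℝ) ^ (m / Q) :=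
      pow_le_pow_of_le_one (by norm_num) (by norm_num) (Nat.div_le_div_right (by omega))
    have hμN : μ ^ N ≤ μ ^ 2 * μ ^ (2 * m) := by
      rw [← pow_add]; exact pow_le_pow_right₀ hμ1 (by omega)
    -- combine
    have hexp : Real.exp (-(9 * Real.sqrt m)) * Real.exp (9 * Real.sqrt m) = 1 := by
      rw [← Real.exp_add]; simp
    have hgoal : C₀ * (1 / 2 : ℝ) ^ (N / Q) * μ ^ N ≤ C₀ * μ ^ 3 * C₁ * #S / (m : ℝ) ^ 3 := by
      rw [le_div_iff₀ (by positivity)]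
      -- `C₀ (1/2)^{N/Q} μ^N m³ ≤ C₀ μ² [(1/2)^{m/Q} e^{9√m} m³] [e^{-9√m} μ^{2m}] ≤ C₀ μ² C₁ (μ #S)`… divided by μ
      have hA : (1 / 2 : ℝ) ^ (N / Q) * μ ^ N * (m : ℝ) ^ 3 ≤
          μ ^ 2 * ((1 / 2 : ℝ) ^ (m / Q) * Real.exp (9 * Real.sqrt m) * (m : ℝ) ^ 3) *
            (Real.exp (-(9 * Real.sqrt m)) * μ ^ (2 * m)) := by
        have e : μ ^ 2 * ((1 / 2 : ℝ) ^ (m / Q) * Real.exp (9 * Real.sqrt m) * (m : ℝ) ^ 3) *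
            (Real.exp (-(9 * Real.sqrt m)) * μ ^ (2 * m)) =
            (1 / 2 : ℝ) ^ (m / Q) * (μ ^ 2 * μ ^ (2 * m)) * (m : ℝ) ^ 3 *
              (Real.exp (-(9 * Real.sqrt m)) * Real.exp (9 * Real.sqrt m)) := by ring
        rw [e, hexp, mul_one]
        have h0 : 0 ≤ (m : ℝ) ^ 3 := by positivity
        exact mul_le_mul_of_nonneg_right (mul_le_mul hhalf hμN (by positivity) (by positivity)) h0
      have hB : μ ^ 2 * ((1 / 2 : ℝ) ^ (m / Q) * Real.exp (9 * Real.sqrt m) * (m : ℝ) ^ 3) *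
            (Real.exp (-(9 * Real.sqrt m)) * μ ^ (2 * m)) ≤ μ ^ 2 * C₁ * (μ * #S) := by
        have := mul_le_mul hana' hlow (by positivity) hC₁.le
        calc _ = μ ^ 2 * (((1 / 2 : ℝ) ^ (m / Q) * Real.exp (9 * Real.sqrt m) * (m : ℝ) ^ 3) *
              (Real.exp (-(9 * Real.sqrt m)) * μ ^ (2 * m))) := by ring
          _ ≤ μ ^ 2 * (C₁ * (μ * #S)) := mul_le_mul_of_nonneg_left this (by positivity)
          _ = μ ^ 2 * C₁ * (μ * #S) := by ring
      -- hence `C₀ (1/2)^{N/Q} μ^N m³ ≤ C₀ μ³ C₁ #S`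
      have hC : C₀ * ((1 / 2 : ℝ) ^ (N / Q) * μ ^ N * (m : ℝ) ^ 3) ≤ C₀ * (μ ^ 2 * C₁ * (μ * #S)) :=
        mul_le_mul_of_nonneg_left (hA.trans hB) hC₀
      calc C₀ * (1 / 2 : ℝ) ^ (N / Q) * μ ^ N * (m : ℝ) ^ 3
          = C₀ * ((1 / 2 : ℝ) ^ (N / Q) * μ ^ N * (m : ℝ) ^ 3) := by ring
        _ ≤ C₀ * (μ ^ 2 * C₁ * (μ * #S)) := hC
        _ = C₀ * μ ^ 3 * C₁ * #S := by ring
    calc _ ≤ C₀ * (1 / 2 : ℝ) ^ (N / Q) * μ ^ N := hup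
      _ ≤ C₀ * μ ^ 3 * C₁ * #S / (m : ℝ) ^ 3 := hgoal
      _ ≤ max ((T : ℝ) ^ 3) (C₀ * μ ^ 3 * C₁) * #S / (m : ℝ) ^ 3 := by
          gcongr
          exact le_max_right _ _

end Density

/-! ### Assembly: Kesten's two-step inequality for `h_N(ℍ)` -/

section Assembly

/-- **K79 along one parity class** `N = 2m + δ`: the three counts (P1-H), (P2-H), (P3-H) give Kesten's
inequality `φ_M² − D/m ≤ φ_M φ_{M+2}`, `M = 2m + δ`, eventually in `m`, by the no-growth abstract assembly
`SAW.kesten_ineq_of_transfer_noGrowth` with `S m := hexHalfFin (2m + δ)`, `I = #hexSlotsH`, `J = #hexSharpH`.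
[cite: MadrasSlade1993, Theorem 7.3.2 (proof, (7.3.5)–(7.3.12), pp. 245–247, inside a sub-class W_N)] -/
theorem hexHalfSpaceKestenTwo_parity {δ : ℕ} (hδ : δ ≤ 1) :
    ∃ D : ℝ, ∀ᶠ m : ℕ in atTop,
      ((#(hexHalfFin (2 * m + δ + 2)) : ℝ) / #(hexHalfFin (2 * m + δ))) ^ 2 - D / m ≤
        ((#(hexHalfFin (2 * m + δ + 2)) : ℝ) / #(hexHalfFin (2 * m + δ))) *
          ((#(hexHalfFin (2 * m + δ + 2 + 2)) : ℝ) / #(hexHalfFin (2 * m + δ + 2))) := by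
  obtain ⟨a, ha, C, hC0, hC⟩ := halfKesten_P3 hδ
  have hidx1 : ∀ m : ℕ, 2 * (m + 1) + δ = 2 * m + δ + 2 := fun m => by ring
  have hidx2 : ∀ m : ℕ, 2 * (m + 2) + δ = 2 * m + δ + 2 + 2 := fun m => by ring
  have key := kesten_ineq_of_transfer_noGrowth (α := List HV) (fun m => hexHalfFin (2 * m + δ))
    (fun _ ω => #(hexSlotsH ω)) (fun _ ω => #(hexSharpH ω)) 1 (a := a) (C := C)
    (c₁ := 27) (c₂ := 324) (c₃ := 53) (c₄ := 81) ha hC0 (by norm_num) (by norm_num) (by norm_num) (by norm_num)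
    (fun m _ => card_hexHalfFin_pos _)
    (fun m hm ω hω => by
      have h := card_hexSlotsH_le (ω := ω)
      have hl := length_of_mem_sawFin (mem_sawFin_of_mem_hexHalfFin hω)
      have h' : #(hexSlotsH ω) ≤ 81 * m := by rw [hl] at h; clear hω; omega
      calc ((#(hexSlotsH ω) : ℕ) : ℝ) ≤ ((81 * m : ℕ) : ℝ) := by exact_mod_cast h'
        _ = 81 * (m : ℝ) := by push_cast; ring)
    (fun m _ => by simp only [hidx1]; exact halfKesten_P1' (2 * m + δ))
    (fun m _ => by
      simp only [hidx2]
      refine le_trans (sum_le_sum fun ω _ => ?_) (halfKesten_P2 (2 * m + δ))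
      set I : ℝ := (#(hexSlotsH ω) : ℝ)
      set J : ℝ := (#(hexSharpH ω) : ℝ)
      have hI0 : 0 ≤ I := Nat.cast_nonneg _
      have hJ0 : 0 ≤ J := Nat.cast_nonneg _
      have hden : 0 < (J + 27) * (J + 54) := by positivity
      have hden' : 0 < (J + 53) * (J + 53 + 1) := by positivity
      by_cases h324 : 324 ≤ I
      · have hmax : max 0 (I - 324) = I - 324 := max_eq_right (by linarith)
        rw [hmax]
        apply div_le_div_of_nonneg_left (by nlinarith) hden
        nlinarith
      · have hneg : I * (I - 324) / ((J + 53) * (J + 53 + 1)) ≤ 0 :=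
          div_nonpos_of_nonpos_of_nonneg (by nlinarith) hden'.le
        have hpos : 0 ≤ I * max 0 (I - 324) / ((J + 27) * (J + 54)) := by positivity
        linarith)
    (fun m _ hm => hC m hm)
  obtain ⟨D, hD⟩ := key
  refine ⟨D, ?_⟩
  filter_upwards [hD] with m h
  simpa only [hidx1, hidx2] using h

/-- **Kesten's two-step inequality for half-space walks on `ℍ`** (crux K79 of the lane's door R79): with
`h_N = HexBW.halfSpaceCount N`, `∃ D, ∀ᶠ N, (h_{N+2}/h_N)² − D/N ≤ (h_{N+2}/h_N)(h_{N+4}/h_{N+2})` — hypothesis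
(iii), eq. (7.3.1), of Madras–Slade Lemma 7.3.1 for `a_N = h_N(ℍ)` (the two parity classes merged by
`kestenIneqTwo_of_parity`). Not in print for `ℍ` (on `ℤ^d` the one-step half-space ratio LIMIT `h_{N+1}/h_N → μ` is
Lawler–Schramm–Werner 2004 (A.3)). [cite: MadrasSlade1993, Theorem 7.3.2 (b) (7.3.4) p. 244 and Lemma 7.3.1 (iii) (7.3.1) p. 242; proof of Theorem 7.3.2 p. 245 (sub-class W_N)] -/
theorem hexHalfSpaceKestenTwo : ∃ D : ℝ, ∀ᶠ N : ℕ in atTop,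
    ((HexBW.halfSpaceCount (N + 2) : ℝ) / HexBW.halfSpaceCount N) ^ 2 - D / N ≤
      ((HexBW.halfSpaceCount (N + 2) : ℝ) / HexBW.halfSpaceCount N) *
        ((HexBW.halfSpaceCount (N + 4) : ℝ) / HexBW.halfSpaceCount (N + 2)) := by
  have h := kestenIneqTwo_of_parity
    (φ := fun N => (HexBW.halfSpaceCount (N + 2) : ℝ) / HexBW.halfSpaceCount N) fun δ hδ => by
      obtain ⟨D, hD⟩ := hexHalfSpaceKestenTwo_parity hδ
      refine ⟨D, ?_⟩
      filter_upwards [hD] with m hm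
      simpa only [card_hexHalfFin] using hm
  simpa using h

end Assembly

end Literature.Probability.RandomPlanarGeometry.SAW.HV
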